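import Summits.ABC.ABC.Theorems.PlatonicClosureOctahedral
import HarnessLib

/-!
# PlatonicClosureCloses — part 3/5 of the node file `PlatonicClosure` (door J, second layer; lens-1 gen 7)

Source: lens-1 g7 `PlatonicClosure.lean` v2.1 (cell `decomp-abc`; sha256 `05826916bf38e332…`; lens + critic + writer
`lean check` rc 0, 0 sorry, axioms standard; critic CLEARED decomp-abc STATUS l.470 / l.479 / l.490).

This module: §6 `closes7`, `sphericalABC_of_pieces`, `pieces_of_sphericalABC`, `abc_iff_octahedral` · §7 the power
lift `pow_transport`, `deloc`, `deloc_iff`, nested / evanescent supports · §7b the dihedral lift `dihedral_core`,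
`dihedral_loaded`, `dihedral_iff`.

Landing form: MECHANICAL five-module split of the source (full account in part 1/5 `PlatonicClosureTransport`): namespace
`Summit.ABC.ABC.Theorems.PlatonicClosure` + `open Summit.ABC.ABC.Theses` (`RootDecompJ/B/G.…` = the TREE decls, as in the source), docstrings,
imports, `private` copies of landed folklore lemmas; statements and proofs byte-identical.  Proves neither `ABC` nor any item (`--supports`).
-/

set_option linter.dupNamespace false
-- lint debt, justified: verbatim planner-cleared proofs keep the item texts' binder names (some hypotheses are unused by name).
set_option linter.unusedVariables false

open Literature.NumberTheory.DiophantineGeometry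
open UniqueFactorizationMonoid
open Finset
-- the route decls of doors J / B / G are referred to as `RootDecompJ.…`, `RootDecompB.…`, `RootDecompG.…` (TREE decls, by name)
open Summit.ABC.ABC.Theses

namespace Summit.ABC.ABC.Theorems.PlatonicClosure

/-! Private verbatim copies (gate `dedup.landed`: these folklore statements are already landed elsewhere in the tree;
they are `private` in their home module of this split) — so that every proof below stays byte-identical to the source. -/
/-- `radical (m * n) ≤ radical m * radical n`. -/
private theorem radical_mul_le (m n : ℕ) : radical (m * n) ≤ radical m * radical n :=
  Nat.le_of_dvd (Nat.mul_pos (Nat.radical_pos _) (Nat.radical_pos _)) radical_mul_dvd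

/-- For a coprime triple, `rad(abc) = rad a · rad b · rad c`. -/
private theorem rad_eq_prod {a b c : ℕ} (ht : IsABCTriple a b c) : rad a b c = radical a * radical b * radical c := by
  obtain ⟨ha, hb, habc, hcop⟩ := ht
  have hac : Nat.Coprime a c := by rw [← habc]; exact Nat.coprime_self_add_right.mpr hcop
  have hbc : Nat.Coprime b c := by rw [← habc]; exact Nat.coprime_add_self_right.mpr hcop.symm
  rw [rad_def, radical_mul (Nat.coprime_iff_isRelPrime.mp (Nat.Coprime.mul_left hac hbc)),
    radical_mul (Nat.coprime_iff_isRelPrime.mp hcop)]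

/-! ## §6  The deciding theorem `closes7` -/

/-- the receiving class of the octahedral transport -/
def Q7 (a b c : ℕ) : Prop := HypType a b c ∨ EucShape a b c ∨ IcoCell a b c ∨ OctCell a b c

/-- The profile `(2,4,3)` is an octahedral signature. -/
theorem octSig_243 : OctSig 2 4 3 := by unfold OctSig; omega

/-- a triple of profile `≥ (2,4,3)` lies in `Hyp ∪ Euc ∪ IcoCell ∪ OctCell`. -/
theorem q7_of_prof243 {a b c : ℕ} (h2 : Adm 2 a) (h4 : Adm 4 b) (h3 : Adm 3 c) : Q7 a b c := by
  rcases hyp_or_euc_or_sph a b c with h | h | h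
  · exact Or.inl h
  · exact Or.inr (Or.inl h)
  · have hL : Lvl234 a b c := ⟨2, 4, 3, h2, h4, h3, octSig_243⟩
    by_cases hI : Lvl235 a b c
    · exact Or.inr (Or.inr (Or.inl ⟨h, hI⟩))
    · exact Or.inr (Or.inr (Or.inr ⟨h, hL, hI⟩))

/-- `P_H` (door J's `CampanaHyperbolicBound`) gives abc on the hyperbolic cell (a bounded cell). -/
theorem abcOn_hyp_of_bound (hH : RootDecompJ.CampanaHyperbolicBound) : AbcOn HypType := by
  obtain ⟨B, hB⟩ := hH
  exact abcOn_of_bounded (B := B) fun a b c ht hq => hB a b c ht hq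

/-- The four pieces `P_H, P_E, P_I, P_O` give abc on the receiving class `Q7 = Hyp ∪ Euc ∪ IcoCell ∪ OctCell`. -/
theorem abcOn_q7 (hH : RootDecompJ.CampanaHyperbolicBound) (hE : RootDecompJ.EuclideanABC)
    (hI : IcosahedralABC) (hO : OctahedralABC) : AbcOn Q7 :=
  abcOn_or (abcOn_hyp_of_bound hH) (abcOn_or (euclideanABC_iff.mp hE)
    (abcOn_or (icosahedralABC_iff.mp hI) (octahedralABC_iff.mp hO)))

/-- **DECIDING THEOREM (gen 7)**: `P_H → P_E → P_I → P_O → ABC`, by the octahedral transport: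
every abc triple maps into `Q7` with `c²⁴ ≤ 2²⁴·c'` and `rad' ≤ 470016·rad·c²³`; then `abc_of_transport`. -/
theorem closes7 (hH : RootDecompJ.CampanaHyperbolicBound) (hE : RootDecompJ.EuclideanABC)
    (hI : IcosahedralABC) (hO : OctahedralABC) : _root_.ABC := by
  refine abc_of_transport (abcOn_q7 hH hE hI hO) (k := 23) (A := 2 ^ 24) (K := 470016)
    (by positivity) (by norm_num) fun a b c ht => ?_
  obtain ⟨x, y, hyx, hy, hco, hodd, hc2x, hxc, hr⟩ := exists_frame ht
  obtain ⟨a', b', c', ht', ⟨h2, h4, h3⟩, hc', hrad'⟩ := octa_core hyx hy hco hodd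
  refine ⟨a', b', c', ht', q7_of_prof243 h2 h4 h3, ?_, ?_⟩
  · calc c ^ (23 + 1) ≤ (2 * x) ^ 24 := Nat.pow_le_pow_left hc2x 24
      _ = 2 ^ 24 * x ^ 24 := by rw [mul_pow]
      _ ≤ 2 ^ 24 * c' := Nat.mul_le_mul_left _ hc'
  · calc rad a' b' c' ≤ 235008 * radical (x * y * (x + y) * (x - y)) * x ^ 22 := hrad'
      _ ≤ 235008 * (2 * c * rad a b c) * c ^ 22 :=
          Nat.mul_le_mul (Nat.mul_le_mul_left _ hr) (Nat.pow_le_pow_left hxc 22)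
      _ = 470016 * rad a b c * c ^ 23 := by ring

/-- The gen-7 assembly `Assembly7` holds (by `closes7`). -/
theorem assembly7_holds : Assembly7 := closes7

/-- **The gen-6 residual is DECORATIVE in the gen-7 node**: `P_S` follows from the four gen-7 pieces. -/
theorem sphericalABC_of_pieces (hH : RootDecompJ.CampanaHyperbolicBound) (hE : RootDecompJ.EuclideanABC)
    (hI : IcosahedralABC) (hO : OctahedralABC) : RootDecompJ.SphericalABC :=
  sphericalABC_iff.mpr (abcOn_of_abc (closes7 hH hE hI hO) SphType)

/-- the split of the gen-6 residual: `P_S ⟹ P_I ∧ P_O` (restrictions) … -/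
theorem pieces_of_sphericalABC (hS : RootDecompJ.SphericalABC) : IcosahedralABC ∧ OctahedralABC :=
  ⟨icosahedralABC_iff.mpr (abcOn_mono (fun _ _ _ h => h.1) (sphericalABC_iff.mp hS)),
    octahedralABC_iff.mpr (abcOn_mono (fun _ _ _ h => h.1) (sphericalABC_iff.mp hS))⟩

/-- … and, given the thin pieces, `P_S ⟺ P_I ∧ P_O ⟺ P_O` (the residual LOCALISES on the octahedral cell). -/
theorem sphericalABC_iff_octahedral (hH : RootDecompJ.CampanaHyperbolicBound) (hE : RootDecompJ.EuclideanABC)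
    (hI : IcosahedralABC) : RootDecompJ.SphericalABC ↔ OctahedralABC :=
  ⟨fun hS => (pieces_of_sphericalABC hS).2, fun hO => sphericalABC_of_pieces hH hE hI hO⟩

/-- Given `P_H, P_E, P_I`, the summit `ABC` is equivalent to the declared residual `OctahedralABC`. -/
theorem abc_iff_octahedral (hH : RootDecompJ.CampanaHyperbolicBound) (hE : RootDecompJ.EuclideanABC)
    (hI : IcosahedralABC) : _root_.ABC ↔ OctahedralABC :=
  ⟨fun h => octahedralABC_iff.mpr (abcOn_of_abc h _), fun hO => closes7 hH hE hI hO⟩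

/-! ## §7  DELOCALISATION of the residual: the power lift (profile `(N, 1, N)`, every `N`)

`(a,b,c) ↦ (aᴺ, cᴺ - aᴺ, cᴺ)`: three rational special points `0, 1, ∞` of `t ↦ tᴺ`; gain one power of `c`.
Hence `ABC ⟺ P_H ∧ P_E ∧ abc|PowCell N` for EVERY `N`, where `PowCell N` = spherical triples with `a` and `c` both
`N`-full (population `≍ B^{2/N}`); the cells are nested in `N` and no triple lies in all of them. -/

/-- spherical triples whose first and last members are `N`-full. -/
def PowCell (N : ℕ) (a b c : ℕ) : Prop := SphType a b c ∧ Adm N a ∧ Adm N c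

/-- `c^(k+1) - a^(k+1) ≤ (k+1) · c^k · (c - a)` for `0 ≤ a ≤ c` in `ℤ`. -/
theorem pow_sub_pow_le (a c : ℤ) (ha : 0 ≤ a) (hac : a ≤ c) (k : ℕ) :
    c ^ (k + 1) - a ^ (k + 1) ≤ ((k : ℤ) + 1) * c ^ k * (c - a) := by
  induction k with
  | zero => simp
  | succ n ih =>
    have hc : 0 ≤ c := ha.trans hac
    have e : c ^ (n + 1 + 1) - a ^ (n + 1 + 1) = c * (c ^ (n + 1) - a ^ (n + 1)) + a ^ (n + 1) * (c - a) := by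
      ring
    rw [e]
    have h1 : c * (c ^ (n + 1) - a ^ (n + 1)) ≤ c * (((n : ℤ) + 1) * c ^ n * (c - a)) :=
      mul_le_mul_of_nonneg_left ih hc
    have h2 : a ^ (n + 1) * (c - a) ≤ c ^ (n + 1) * (c - a) :=
      mul_le_mul_of_nonneg_right (pow_le_pow_left₀ ha hac _) (by linarith)
    calc _ ≤ c * (((n : ℤ) + 1) * c ^ n * (c - a)) + c ^ (n + 1) * (c - a) := add_le_add h1 h2
      _ = (((n + 1 : ℕ) : ℤ) + 1) * c ^ (n + 1) * (c - a) := by push_cast; ring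

/-- THE POWER LIFT (degree `k+1`): image profile `≥ (k+1, 1, k+1)`, `c^{k+1} = c'`, `rad' ≤ (k+1)·rad·cᵏ`. -/
theorem pow_transport (k : ℕ) {a b c : ℕ} (ht : IsABCTriple a b c) :
    ∃ a' b' c' : ℕ, IsABCTriple a' b' c' ∧ (Adm (k + 1) a' ∧ Adm (k + 1) c') ∧
      c ^ (k + 1) ≤ 1 * c' ∧ rad a' b' c' ≤ (k + 1) * rad a b c * c ^ k := by
  obtain ⟨ha0, hb0, hc0, hac, hbc⟩ := triple_facts ht
  obtain ⟨ha, hb, habc, hcop⟩ := ht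
  have hN0 : k + 1 ≠ 0 := by omega
  have hlt : a ^ (k + 1) < c ^ (k + 1) := Nat.pow_lt_pow_left hac hN0
  have hcopac : Nat.Coprime a c := by rw [← habc]; exact Nat.coprime_self_add_right.mpr hcop
  refine ⟨a ^ (k + 1), c ^ (k + 1) - a ^ (k + 1), c ^ (k + 1),
    ⟨by positivity, Nat.sub_pos_of_lt hlt, Nat.add_sub_of_le hlt.le, ?_⟩,
    ⟨adm_pow hN0 ha0, adm_pow hN0 hc0⟩, by rw [one_mul], ?_⟩
  · -- coprime
    apply Nat.Coprime.pow_left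
    have h1 : Nat.Coprime a (c ^ (k + 1)) := hcopac.pow_right (k + 1)
    have e : c ^ (k + 1) - a ^ (k + 1) + a ^ k * a = c ^ (k + 1) := by
      rw [← pow_succ]; exact Nat.sub_add_cancel hlt.le
    rw [← e] at h1
    exact (Nat.coprime_add_mul_right_right _ _ _).mp h1
  · -- radical bound
    have hdvd : b ∣ c ^ (k + 1) - a ^ (k + 1) := by
      have := Nat.sub_dvd_pow_sub_pow c a (k + 1)
      rwa [show c - a = b by omega] at this
    obtain ⟨G, hG⟩ := hdvd
    have hG0 : 0 < G := by
      rcases Nat.eq_zero_or_pos G with h | h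
      · rw [h, mul_zero] at hG; exact absurd hG (Nat.sub_pos_of_lt hlt).ne'
      · exact h
    have hGle : G ≤ (k + 1) * c ^ k := by
      have h1 : ((c : ℤ) ^ (k + 1) - a ^ (k + 1)) ≤ ((k : ℤ) + 1) * c ^ k * (c - a) :=
        pow_sub_pow_le a c (by positivity) (by exact_mod_cast hac.le) k
      have h2 : ((c ^ (k + 1) - a ^ (k + 1) : ℕ) : ℤ) = (b : ℤ) * G := by exact_mod_cast hG
      rw [Nat.cast_sub hlt.le] at h2
      push_cast at h2
      rw [h2, show ((c : ℤ) - a) = b by rw [← habc]; push_cast; ring] at h1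
      have h3 : (b : ℤ) * G ≤ (b : ℤ) * (((k : ℤ) + 1) * c ^ k) := by linarith
      have h4 : (G : ℤ) ≤ ((k : ℤ) + 1) * c ^ k := le_of_mul_le_mul_left h3 (by exact_mod_cast hb)
      exact_mod_cast h4
    calc rad (a ^ (k + 1)) (c ^ (k + 1) - a ^ (k + 1)) (c ^ (k + 1))
        = radical (a ^ (k + 1) * (c ^ (k + 1) - a ^ (k + 1)) * c ^ (k + 1)) := rad_def _ _ _
      _ ≤ radical (a ^ (k + 1)) * radical (c ^ (k + 1) - a ^ (k + 1)) * radical (c ^ (k + 1)) :=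
          (radical_mul_le _ _).trans (Nat.mul_le_mul_right _ (radical_mul_le _ _))
      _ = radical a * radical (b * G) * radical c := by rw [radical_pow _ hN0, radical_pow _ hN0, hG]
      _ ≤ radical a * (radical b * G) * radical c :=
          Nat.mul_le_mul_right _ (Nat.mul_le_mul_left _ (radical_mul_le_mul_self _ hG0))
      _ = rad a b c * G := by rw [rad_eq_prod ⟨ha, hb, habc, hcop⟩]; ring
      _ ≤ rad a b c * ((k + 1) * c ^ k) := Nat.mul_le_mul_left _ hGle
      _ = (k + 1) * rad a b c * c ^ k := by ring

/-- the receiving class of the power lift -/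
def QPow (k : ℕ) (a b c : ℕ) : Prop := HypType a b c ∨ EucShape a b c ∨ PowCell (k + 1) a b c

/-- **DELOCALISATION**: for every `N = k+1 ≥ 1`, `P_H → P_E → abc|PowCell N → ABC`. -/
theorem deloc (k : ℕ) (hH : RootDecompJ.CampanaHyperbolicBound) (hE : RootDecompJ.EuclideanABC)
    (hP : AbcOn (PowCell (k + 1))) : _root_.ABC := by
  have hQ : AbcOn (QPow k) := abcOn_or (abcOn_hyp_of_bound hH) (abcOn_or (euclideanABC_iff.mp hE) hP)
  refine abc_of_transport hQ (k := k) (A := 1) (K := k + 1) one_pos (Nat.succ_pos k) fun a b c ht => ?_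
  obtain ⟨a', b', c', ht', ⟨hA, hC⟩, hc', hr'⟩ := pow_transport k ht
  refine ⟨a', b', c', ht', ?_, hc', hr'⟩
  rcases hyp_or_euc_or_sph a' b' c' with h | h | h
  · exact Or.inl h
  · exact Or.inr (Or.inl h)
  · exact Or.inr (Or.inr ⟨h, hA, hC⟩)

/-- Delocalisation, iff form: given `P_H, P_E`, `ABC ↔ AbcOn (PowCell (k+1))` for every `k`. -/
theorem deloc_iff (k : ℕ) (hH : RootDecompJ.CampanaHyperbolicBound) (hE : RootDecompJ.EuclideanABC) :
    _root_.ABC ↔ AbcOn (PowCell (k + 1)) :=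
  ⟨fun h => abcOn_of_abc h _, deloc k hH hE⟩

/-- the supports are nested … -/
theorem powCell_nested {k a b c : ℕ} (h : PowCell (k + 2) a b c) : PowCell (k + 1) a b c :=
  ⟨h.1, adm_mono h.2.1 (by omega) (by omega), adm_mono h.2.2 (by omega) (by omega)⟩

/-- … and EVANESCENT: no abc triple lies in all of them. -/
theorem powCell_evanescent {a b c : ℕ} (ht : IsABCTriple a b c) : ∃ k : ℕ, ¬ PowCell (k + 1) a b c := by
  obtain ⟨ha0, hb0, hc0, hac, hbc⟩ := triple_facts ht
  have hc1 : c ≠ 1 := by omega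
  obtain ⟨ℓ, hℓ, hℓc⟩ := Nat.exists_prime_and_dvd hc1
  refine ⟨c.factorization ℓ, fun h => ?_⟩
  have := h.2.2.2 ℓ (Nat.mem_primeFactors.2 ⟨hℓ, hℓc, hc0⟩)
  omega

/-! ## §7b  The dihedral lift `D_N` (profile `(2, N, 2)`, every `N`)

`(xᴺ + yᴺ)² = (xᴺ - yᴺ)² + 4·(xy)ᴺ` on a frame `(x,y)` of the triple (four rational special points `0, ∞, ±1` of the
dihedral Belyi map): image profile `≥ (2, N, 2)`, `c^{2N} ≤ 4ᴺ·c'`, `rad' ≤ 4N·rad·c^{2N-1}`.  Hence the DIHEDRAL LEVELS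
`Δ_N` (all members squareful, one member `N`-full) are loaded for every `N` as well. -/

/-- spherical triples of profile `≥ (2, N, 2)`. -/
def DihCell (N : ℕ) (a b c : ℕ) : Prop := SphType a b c ∧ Adm 2 a ∧ Adm N b ∧ Adm 2 c

/-- THE DIHEDRAL CORE TRANSPORT on a frame `y < x`, `gcd 1`, `x + y` odd, exponent `N = m+1`:
image `((xᴺ-yᴺ)², 4(xy)ᴺ, (xᴺ+yᴺ)²)`, profile `≥ (2,N,2)`, `x^{2N} ≤ c'`, `rad' ≤ 2N · rad(xy(x+y)(x-y)) · x^{2m}`. -/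
theorem dihedral_core (m : ℕ) {x y : ℕ} (hyx : y < x) (hy : 0 < y) (hco : Nat.Coprime x y) (hodd : Odd (x + y)) :
    ∃ a' b' c' : ℕ, IsABCTriple a' b' c' ∧ (Adm 2 a' ∧ Adm (m + 1) b' ∧ Adm 2 c') ∧
      x ^ (2 * m + 2) ≤ c' ∧ rad a' b' c' ≤ 2 * (m + 1) * radical (x * y * (x + y) * (x - y)) * x ^ (2 * m) := by
  have hx : 0 < x := lt_of_le_of_lt (Nat.zero_le y) hyx
  have hN0 : m + 1 ≠ 0 := by omega
  have hXY : y ^ (m + 1) < x ^ (m + 1) := Nat.pow_lt_pow_left hyx hN0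
  have hx2y2 : y ^ 2 < x ^ 2 := Nat.pow_lt_pow_left hyx two_ne_zero
  have hX0 : 0 < x ^ (m + 1) := by positivity
  have hY0 : 0 < y ^ (m + 1) := by positivity
  -- parity: x*y is even, x^N - y^N is odd
  have hxy_even : Even (x * y) := by
    rcases Nat.even_or_odd x with hx' | hx'
    · exact hx'.mul_right y
    · rcases Nat.even_or_odd y with hy' | hy'
      · exact hy'.mul_left x
      · exact absurd hodd (Nat.not_odd_iff_even.mpr (Odd.add_odd hx' hy'))
  have hdiff_odd : Odd (x ^ (m + 1) - y ^ (m + 1)) := by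
    rw [Nat.odd_sub hXY.le]
    rcases Nat.even_or_odd x with hx' | hx'
    · have hy' : Odd y := by
        rcases Nat.even_or_odd y with h | h
        · exact absurd hodd (Nat.not_odd_iff_even.mpr (hx'.add h))
        · exact h
      exact ⟨fun h => absurd (Even.pow_of_ne_zero hx' hN0) (Nat.not_even_iff_odd.mpr h),
        fun h => absurd (Odd.pow hy') (Nat.not_odd_iff_even.mpr h)⟩
    · have hy' : Even y := by
        rcases Nat.even_or_odd y with h | h
        · exact h
        · exact absurd hodd (Nat.not_odd_iff_even.mpr (Odd.add_odd hx' h))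
      exact ⟨fun _ => Even.pow_of_ne_zero hy' hN0, fun _ => Odd.pow hx'⟩
  -- the cofactor G : (x²)ᴺ - (y²)ᴺ = (x² - y²) G, G ≤ N x^{2m}
  obtain ⟨G, hG⟩ := Nat.sub_dvd_pow_sub_pow (x ^ 2) (y ^ 2) (m + 1)
  have hD : (x ^ (m + 1)) ^ 2 - (y ^ (m + 1)) ^ 2 = (x ^ 2 - y ^ 2) * G := by
    rw [← hG, ← pow_mul, ← pow_mul, ← pow_mul, ← pow_mul, mul_comm (m + 1) 2]
  have hG0 : 0 < G := by
    rcases Nat.eq_zero_or_pos G with h | h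
    · rw [h, mul_zero] at hG
      exact absurd hG (Nat.sub_pos_of_lt (Nat.pow_lt_pow_left hx2y2 hN0)).ne'
    · exact h
  have hGle : G ≤ (m + 1) * x ^ (2 * m) := by
    have h1 := pow_sub_pow_le ((y : ℤ) ^ 2) ((x : ℤ) ^ 2) (by positivity) (by exact_mod_cast hx2y2.le) m
    have h2 : (((x ^ 2) ^ (m + 1) - (y ^ 2) ^ (m + 1) : ℕ) : ℤ) = ((x ^ 2 - y ^ 2 : ℕ) : ℤ) * G := by
      exact_mod_cast hG
    rw [Nat.cast_sub (Nat.pow_le_pow_left hx2y2.le _), Nat.cast_sub hx2y2.le] at h2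
    push_cast at h2
    rw [h2] at h1
    have hpos : (0 : ℤ) < (x : ℤ) ^ 2 - (y : ℤ) ^ 2 := by
      have : ((y ^ 2 : ℕ) : ℤ) < ((x ^ 2 : ℕ) : ℤ) := by exact_mod_cast hx2y2
      push_cast at this; linarith
    have h3 : ((x : ℤ) ^ 2 - (y : ℤ) ^ 2) * G ≤ ((x : ℤ) ^ 2 - (y : ℤ) ^ 2) * (((m : ℤ) + 1) * (x ^ 2) ^ m) := by
      linarith
    have h4 : (G : ℤ) ≤ ((m : ℤ) + 1) * (x ^ 2) ^ m := le_of_mul_le_mul_left h3 hpos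
    rw [← pow_mul] at h4
    exact_mod_cast h4
  -- the image
  refine ⟨(x ^ (m + 1) - y ^ (m + 1)) ^ 2, 4 * (x * y) ^ (m + 1), (x ^ (m + 1) + y ^ (m + 1)) ^ 2,
    ⟨pow_pos (Nat.sub_pos_of_lt hXY) 2, by positivity, ?_, ?_⟩, ⟨adm_pow two_ne_zero (Nat.sub_pos_of_lt hXY).ne', ?_,
      adm_pow two_ne_zero (by positivity)⟩, ?_, ?_⟩
  · -- sum
    zify [hXY.le]
    ring
  · -- coprime
    apply Nat.Coprime.pow_left 2
    apply Nat.Coprime.mul_right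
    · -- coprime to 4
      have h2 : Nat.Coprime (x ^ (m + 1) - y ^ (m + 1)) 2 :=
        (Nat.coprime_comm.trans (Nat.Prime.coprime_iff_not_dvd Nat.prime_two)).mpr
          (by rw [← even_iff_two_dvd]; exact Nat.not_even_iff_odd.mpr hdiff_odd)
      simpa using h2.pow_right 2
    · apply Nat.Coprime.pow_right
      refine Nat.coprime_of_dvd fun ℓ hℓ hk hxy => ?_
      have hX : ℓ ∣ x ^ (m + 1) ∨ ℓ ∣ y ^ (m + 1) := by
        rcases (Nat.Prime.dvd_mul hℓ).mp hxy with h | h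
        · exact Or.inl (dvd_pow h hN0)
        · exact Or.inr (dvd_pow h hN0)
      -- from ℓ ∣ X - Y and ℓ ∣ X (or Y) get ℓ ∣ both, hence ℓ ∣ x and ℓ ∣ y
      have hboth : ℓ ∣ x ^ (m + 1) ∧ ℓ ∣ y ^ (m + 1) := by
        rcases hX with h | h
        · refine ⟨h, ?_⟩
          have := Nat.dvd_sub h hk
          rwa [Nat.sub_sub_self hXY.le] at this
        · exact ⟨by have := Nat.dvd_add h hk; rwa [Nat.add_sub_cancel' hXY.le] at this, h⟩
      have := Nat.eq_one_of_dvd_coprimes hco (hℓ.dvd_of_dvd_pow hboth.1) (hℓ.dvd_of_dvd_pow hboth.2)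
      exact hℓ.one_lt.ne' this
  · -- b' is N-full
    refine adm_of_pow_dvd (n := x * y) hN0 (by positivity) (Dvd.intro_left 4 rfl) fun ℓ hℓ h => ?_
    rcases (Nat.Prime.dvd_mul hℓ).mp h with h4 | h4
    · have h22 : ℓ ∣ 2 ^ 2 := by norm_num; exact h4
      have := (Nat.prime_dvd_prime_iff_eq hℓ Nat.prime_two).mp (hℓ.dvd_of_dvd_pow h22)
      subst this
      exact even_iff_two_dvd.mp hxy_even
    · exact hℓ.dvd_of_dvd_pow h4
  · -- size
    calc x ^ (2 * m + 2) = (x ^ (m + 1)) ^ 2 := by rw [← pow_mul]; ring_nf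
      _ ≤ (x ^ (m + 1) + y ^ (m + 1)) ^ 2 := Nat.pow_le_pow_left (Nat.le_add_right _ _) 2
  · -- radical
    set P := x * y * (x + y) * (x - y) with hP
    set D := (x ^ (m + 1)) ^ 2 - (y ^ (m + 1)) ^ 2 with hDdef
    have hPG : P * G = x * y * D := by
      rw [hD, hP]
      have : (x + y) * (x - y) = x ^ 2 - y ^ 2 := by rw [Nat.sq_sub_sq]
      rw [← this]; ring
    have hAC : (x ^ (m + 1) - y ^ (m + 1)) ^ 2 * (x ^ (m + 1) + y ^ (m + 1)) ^ 2 = D ^ 2 := by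
      rw [hDdef]
      zify [hXY.le, Nat.pow_le_pow_left hXY.le 2]
      ring
    have hP0 : 0 < P := by
      rw [hP]; have := Nat.sub_pos_of_lt hyx; positivity
    have hD0 : 0 < D := by rw [hDdef]; exact Nat.sub_pos_of_lt (Nat.pow_lt_pow_left hXY two_ne_zero)
    have key : (2 * P * G) ^ (m + 1 + 2) =
        ((x ^ (m + 1) - y ^ (m + 1)) ^ 2 * (4 * (x * y) ^ (m + 1)) * (x ^ (m + 1) + y ^ (m + 1)) ^ 2) *
          (2 ^ (m + 1) * (x * y) ^ 2 * D ^ (m + 1)) := by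
      have e1 : (x ^ (m + 1) - y ^ (m + 1)) ^ 2 * (4 * (x * y) ^ (m + 1)) * (x ^ (m + 1) + y ^ (m + 1)) ^ 2 =
          4 * (x * y) ^ (m + 1) * D ^ 2 := by
        rw [← hAC]; ring
      rw [e1, mul_assoc 2 P G, hPG]
      ring
    have hne : (2 * P * G) ^ (m + 1 + 2) ≠ 0 := by positivity
    calc rad ((x ^ (m + 1) - y ^ (m + 1)) ^ 2) (4 * (x * y) ^ (m + 1)) ((x ^ (m + 1) + y ^ (m + 1)) ^ 2)
        = radical ((x ^ (m + 1) - y ^ (m + 1)) ^ 2 * (4 * (x * y) ^ (m + 1)) *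
            (x ^ (m + 1) + y ^ (m + 1)) ^ 2) := rad_def _ _ _
      _ ≤ radical ((2 * P * G) ^ (m + 1 + 2)) :=
          Nat.le_of_dvd (Nat.pos_of_ne_zero radical_ne_zero) (radical_dvd_radical (Dvd.intro _ key.symm) hne)
      _ = radical (2 * P * G) := radical_pow _ (by omega)
      _ ≤ radical (2 * P) * radical G := radical_mul_le _ _
      _ ≤ (radical 2 * radical P) * G :=
          Nat.mul_le_mul (radical_mul_le _ _) (radical_le_self hG0)
      _ ≤ (2 * radical P) * ((m + 1) * x ^ (2 * m)) :=
          Nat.mul_le_mul (Nat.mul_le_mul_right _ (radical_le_self two_pos)) hGle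
      _ = 2 * (m + 1) * radical P * x ^ (2 * m) := by ring

/-- the receiving class of the dihedral lift -/
def QDih (m : ℕ) (a b c : ℕ) : Prop := HypType a b c ∨ EucShape a b c ∨ DihCell (m + 1) a b c

/-- **the dihedral levels are loaded**: for every `N = m+1 ≥ 1`, `P_H → P_E → abc|DihCell N → ABC`. -/
theorem dihedral_loaded (m : ℕ) (hH : RootDecompJ.CampanaHyperbolicBound) (hE : RootDecompJ.EuclideanABC)
    (hD : AbcOn (DihCell (m + 1))) : _root_.ABC := by
  have hQ : AbcOn (QDih m) := abcOn_or (abcOn_hyp_of_bound hH) (abcOn_or (euclideanABC_iff.mp hE) hD)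
  refine abc_of_transport hQ (k := 2 * m + 1) (A := 2 ^ (2 * m + 2)) (K := 4 * (m + 1)) (by positivity)
    (by positivity) fun a b c ht => ?_
  obtain ⟨x, y, hyx, hy, hco, hodd, hc2x, hxc, hr⟩ := exists_frame ht
  obtain ⟨a', b', c', ht', ⟨h2, hN, h2'⟩, hc', hrad'⟩ := dihedral_core m hyx hy hco hodd
  refine ⟨a', b', c', ht', ?_, ?_, ?_⟩
  · rcases hyp_or_euc_or_sph a' b' c' with h | h | h
    · exact Or.inl h
    · exact Or.inr (Or.inl h)
    · exact Or.inr (Or.inr ⟨h, h2, hN, h2'⟩)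
  · calc c ^ (2 * m + 1 + 1) = c ^ (2 * m + 2) := by ring_nf
      _ ≤ (2 * x) ^ (2 * m + 2) := Nat.pow_le_pow_left hc2x _
      _ = 2 ^ (2 * m + 2) * x ^ (2 * m + 2) := by rw [mul_pow]
      _ ≤ 2 ^ (2 * m + 2) * c' := Nat.mul_le_mul_left _ hc'
  · calc rad a' b' c' ≤ 2 * (m + 1) * radical (x * y * (x + y) * (x - y)) * x ^ (2 * m) := hrad'
      _ ≤ 2 * (m + 1) * (2 * c * rad a b c) * c ^ (2 * m) :=
          Nat.mul_le_mul (Nat.mul_le_mul_left _ hr) (Nat.pow_le_pow_left hxc _)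
      _ = 4 * (m + 1) * rad a b c * c ^ (2 * m + 1) := by ring

/-- Dihedral lift, iff form: given `P_H, P_E`, `ABC ↔ AbcOn (DihCell (m+1))` for every `m`. -/
theorem dihedral_iff (m : ℕ) (hH : RootDecompJ.CampanaHyperbolicBound) (hE : RootDecompJ.EuclideanABC) :
    _root_.ABC ↔ AbcOn (DihCell (m + 1)) :=
  ⟨fun h => abcOn_of_abc h _, dihedral_loaded m hH hE⟩

end Summit.ABC.ABC.Theorems.PlatonicClosure
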